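import Mathlib

set_option linter.dupNamespace false

/-!
# SoloBlind E58 — the Eisenstein part of an old/new congruence module has length `min (c, μ)`

Solo-blind programme (Langlands side study, Eisenstein modulus laws at level `pq`), tower note §13.15.

Setting (informal): `𝕋 ⊂ 𝕋^{old} × 𝕋^{new}` is the Hecke algebra at level `pq` localised at an
Eisenstein maximal ideal, `Λ = (𝕋^{old} × 𝕋^{new}) / 𝕋` the old/new congruence module, and `I` the
Eisenstein ideal with `𝕋/I ≅ ℤ/ℓ^{a+b}` (Yoo), `𝕋^{old}/I ≅ ℤ/ℓ^{c}` and `𝕋^{new}/I ≅ ℤ/ℓ^{μ}`.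
Tensoring the defining sequence with `𝕋/I` shows that `Λ/IΛ` is the quotient of
`ℤ/ℓ^{c} × ℤ/ℓ^{μ}` by the image of `1`, i.e. by the cyclic subgroup generated by `(1,1)`.
This file proves the purely group-theoretic identity behind the slogan
"length of the Eisenstein part of the congruence module = min (c_old, μ)":
the quotient of `ZMod (p^c) × ZMod (p^m)` by the diagonal `ℤ·(1,1)` has exactly `p ^ min c m` elements.

No modular-form object is formalised here; the dictionary is documentation only.
-/

namespace Summit.Langlands.Langlands.Theorems.SoloBlindCongruenceLength

/-- `lcm (p^c, p^m) = p ^ max c m` for any natural `p`. -/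
theorem lcm_pow_pow (p c m : ℕ) : Nat.lcm (p ^ c) (p ^ m) = p ^ max c m := by
  rcases le_total c m with h | h
  · rw [max_eq_right h]
    exact Nat.lcm_eq_right_iff_dvd.mpr (pow_dvd_pow p h)
  · rw [max_eq_left h]
    exact Nat.lcm_eq_left_iff_dvd.mpr (pow_dvd_pow p h)

/-- The diagonal element `(1,1)` of `ZMod (p^c) × ZMod (p^m)` has additive order `p ^ max c m`. -/
theorem addOrderOf_diag (p c m : ℕ) :
    addOrderOf ((1, 1) : ZMod (p ^ c) × ZMod (p ^ m)) = p ^ max c m := by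
  rw [Prod.addOrderOf]
  simp only [ZMod.addOrderOf_one]
  exact lcm_pow_pow p c m

/-- The cyclic subgroup generated by `(1,1)` in `ZMod (p^c) × ZMod (p^m)` has `p ^ max c m` elements. -/
theorem card_diag (p c m : ℕ) :
    Nat.card (AddSubgroup.zmultiples ((1, 1) : ZMod (p ^ c) × ZMod (p ^ m))) = p ^ max c m := by
  rw [Nat.card_zmultiples, addOrderOf_diag]

/-- **E58 (congruence-module length).** For a prime `p`, the quotient of
`ZMod (p^c) × ZMod (p^m)` by the diagonal subgroup `ℤ·(1,1)` has exactly `p ^ min c m` elements.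
Reading (tower §13.15): with `c = c_old` (Eisenstein depth on old forms) and `m = μ` (depth on the
new quotient), the Eisenstein part `Λ/IΛ` of the old/new congruence module has length `min (c_old, μ)`. -/
theorem card_quotient_diag (p c m : ℕ) (hp : p.Prime) :
    Nat.card ((ZMod (p ^ c) × ZMod (p ^ m)) ⧸
        AddSubgroup.zmultiples ((1, 1) : ZMod (p ^ c) × ZMod (p ^ m))) = p ^ min c m := by
  set G := ZMod (p ^ c) × ZMod (p ^ m)
  set H := AddSubgroup.zmultiples ((1, 1) : G)
  have hG : Nat.card G = p ^ c * p ^ m := by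
    simp [G, Nat.card_prod, Nat.card_zmod]
  have hH : Nat.card H = p ^ max c m := card_diag p c m
  have hL := AddSubgroup.card_eq_card_quotient_mul_card_addSubgroup H
  rw [hG, hH] at hL
  have hpos : 0 < p ^ max c m := pow_pos hp.pos _
  have key : p ^ c * p ^ m = p ^ min c m * p ^ max c m := by
    rw [← pow_add, ← pow_add, min_add_max]
  rw [key] at hL
  exact (Nat.eq_of_mul_eq_mul_right hpos hL).symm

/-- Corollary: when the new depth does not exceed the old depth (`m ≤ c`), the quotient has exactly
`p ^ m` elements — "μ is read off as the length of the Eisenstein part of the congruence module". -/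
theorem card_quotient_diag_of_le (p c m : ℕ) (hp : p.Prime) (h : m ≤ c) :
    Nat.card ((ZMod (p ^ c) × ZMod (p ^ m)) ⧸
        AddSubgroup.zmultiples ((1, 1) : ZMod (p ^ c) × ZMod (p ^ m))) = p ^ m := by
  rw [card_quotient_diag p c m hp, min_eq_right h]

end Summit.Langlands.Langlands.Theorems.SoloBlindCongruenceLength
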